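import Literature.MathematicalPhysics.QuantumManyBody.GroundStateFeynmanKacCutLine
import Literature.MathematicalPhysics.QuantumManyBody.GroundStateFeynmanKacOperator
import Literature.MathematicalPhysics.QuantumManyBody.GroundStateFeynmanKacFreeForm
import Literature.MathematicalPhysics.QuantumManyBody.GroundStateFeynmanKacTrialState
import Summits.AtomisticToContinuum.BoseEinsteinCondensation.Theses.BECCutLineWeakDisorder
import HarnessLib

/-!
# Ideator sketch (crux-ideate, ideator 2, round 1) for crux `WitnessTransfer`
(`stmt-AtomisticToContinuum-14978`, route `BECCutLineWeakDisorder`):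
first lemmas of the three idea cards, stated over existing declarations (proofs `sorry`).

* Card `convex-log-partition-slope`: `fkNormSq_one_midpoint_sq_le`, `fkNormSq_one_ge_of_trialState`,
  `exists_finiteT_subEigen` (the first checkable statement of the line).
* Card `level-set-truncation-usc`: `upperSemicontinuous_fkSemigroup_one`, `sqIncr_posPart_sub_le`,
  `exists_separation_of_usc`.
* Card `landscape-ratio-convexity`: `sliceRatio_midpoint_le`, `landscapeRatio_mollify_le`.
-/

noncomputable section

open MeasureTheory Filter Set
open scoped ENNReal NNReal Topology

namespace Summit.AtomisticToContinuum.BoseEinsteinCondensation.Cruxes.WitnessTransfer.IdeatorSketch2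

open Literature.MathematicalPhysics.QuantumManyBody.BoseGas

/-- The crux, by name (sanity: it is the implication engine → hinge). -/
example : Summit.AtomisticToContinuum.BoseEinsteinCondensation.Theses.BECCutLineWeakDisorder.WitnessTransfer =
    (Summit.AtomisticToContinuum.BoseEinsteinCondensation.Theses.BECCutLineWeakDisorder.TwoReplicaTransienceBound →
      Summit.AtomisticToContinuum.BoseEinsteinCondensation.Theses.BECCutLineWeakDisorder.LandscapeBound) := rfl

variable {N : ℕ}

/-! ## Card 1 — `convex-log-partition-slope` -/

/-- Log-convexity (midpoint form) of the partition norm `F(T) = ‖e^{-TH_N}1‖₂²`: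
`F((a+b)/2)² ≤ F(a) F(b)` (semigroup law + symmetry: `F((a+b)/2) = ⟨e^{-aH}1, e^{-bH}1⟩`, then
Cauchy–Schwarz). Valid for EVERY measurable `v : ℝ → [0,∞]`, hard cores included. -/
theorem fkNormSq_one_midpoint_sq_le {v : ℝ → ℝ≥0∞} (hv : Measurable v) (L : ℝ) {a b : ℝ}
    (ha : 0 ≤ a) (hb : 0 ≤ b) :
    fkNormSq (N := N) v L ((a + b) / 2) (fun _ => 1) ^ 2 ≤
      fkNormSq (N := N) v L a (fun _ => 1) * fkNormSq (N := N) v L b (fun _ => 1) := by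
  sorry

/-- Lower envelope of the partition norm by any finite-energy trial state:
`F(T) ≥ K⁻² e^{-2T·E(Φ)}` for a trial state `Φ` with `|Φ| ≤ K` (positivity/domination
`⟨|Φ|, e^{-2TH}|Φ|⟩ ≤ K² ⟨1, e^{-2TH}1⟩` and the Jensen/log-convexity bound
`⟨Φ, e^{-tH}Φ⟩ ≥ ‖Φ‖² e^{-tE(Φ)/‖Φ‖²}` for `C¹` Dirichlet states — for `⊤`-valued or singular `v`
through the monotone truncations `min v k ↑ v` on both sides). -/
theorem fkNormSq_one_ge_of_trialState {v : ℝ → ℝ≥0∞} (hv : IsRepulsiveFiniteRange v) {L : ℝ}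
    (hL : 0 < L) (Φ : TrialState N L) (hE : energy v Φ ≠ ⊤) {K : ℝ} (hK : ∀ X, ‖Φ.ψ X‖ ≤ K)
    {T : ℝ} (hT : 0 ≤ T) :
    ENNReal.ofReal ((K ^ 2)⁻¹ * Real.exp (-(2 * T * (energy v Φ).toReal))) ≤
      fkNormSq (N := N) v L T (fun _ => 1) := by
  sorry

/-- **First lemma of the line (Card 1).** For every admissible `v`, `L > 0` and finite `E₀`, and
every `ε > 0`, there is a FINITE half-length `T ≥ 1` at which the Feynman–Kac witness
`Ψ_T = fkWitness v L T 1` is a genuine normalised function and satisfies the integrated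
sub-eigen relation `⟨Ψ_T, e^{-tH}Ψ_T⟩ ≥ e^{-(E₀+ε)t}` for ALL `t > 0` (slopes of the convex function
`log F` pinched between `log |Λ^N|` and the lower envelope). This is exactly hypothesis `heig` of
`groundStateEnergy_le_ofReal_of_eigen`, now at finite `T`, with no ground state, no
Perron–Frobenius, no `T → ∞`, no nondegeneracy. -/
theorem exists_finiteT_subEigen {v : ℝ → ℝ≥0∞} (hv : IsRepulsiveFiniteRange v) {L : ℝ}
    (hL : 0 < L) (hE : groundStateEnergy v N L ≠ ⊤) {ε : ℝ} (hε : 0 < ε) :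
    ∃ T : ℝ, 1 ≤ T ∧ fkNormSq (N := N) v L T (fun _ => 1) ≠ 0 ∧
      fkNormSq (N := N) v L T (fun _ => 1) ≠ ⊤ ∧
      ∀ t : ℝ, 0 < t →
        Real.exp (-(((groundStateEnergy v N L).toReal + ε) * t)) ≤
          ∫ X : Config N, fkWitness (N := N) v L T (fun _ => (1 : ℝ≥0∞)) X *
            fkReal v L t (fkWitness (N := N) v L T (fun _ => (1 : ℝ≥0∞))) X := by
  sorry

/-! ## Card 2 — `level-set-truncation-usc` -/

/-- **First lemma of the line (Card 2).** Upper semicontinuity of the Feynman–Kac partition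
function `X ↦ (e^{-tH_N}1)(X)` for EVERY measurable `v : ℝ → [0,∞]` (`⊤` allowed): it is the
decreasing limit, as `s ↓ 0`, of the Gaussian-smoothed (hence continuous) functions
`X ↦ E[(e^{-(t-s)H}1)(X + √2 b_s)]` (drop killing and action on `[0,s]`). Chung–Zhao Prop 1.19,
verbatim with the Feynman–Kac weight. -/
theorem upperSemicontinuous_fkSemigroup_one {v : ℝ → ℝ≥0∞} (hv : Measurable v) (L : ℝ)
    {t : ℝ} (ht : 0 < t) :
    UpperSemicontinuous fun X : Config N => fkSemigroup v L t (fun _ => (1 : ℝ≥0∞)) X := by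
  sorry

/-- Level-set truncation is a contraction for the free increment form (`|(a-η)₊ - (b-η)₊| ≤ |a-b|`
pointwise): the kinetic part of the energy can only drop (Beurling–Deny / Markov property of the
energy form). -/
theorem sqIncr_posPart_sub_le (f : Config N → ℝ) (η : ℝ) (t : ℝ≥0) :
    sqIncr t (fun X => max (f X - η) 0) ≤ sqIncr t f := by
  sorry

/-- Support separation: the superlevel set `{u ≥ η}` of an upper semicontinuous `u` that
vanishes on a closed "wall" set `W` and off the box stays at a positive distance from `W`
(compactness of `{u ≥ η} ⊆ closure Λ^N`). Hence `(u - η)₊` vanishes on a NEIGHBOURHOOD of the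
hard-core contact set and can be mollified without touching it. -/
theorem exists_separation_of_usc {u : Config N → ℝ≥0∞} (hu : UpperSemicontinuous u)
    {W : Set (Config N)} (hW : IsClosed W) (h0 : ∀ X ∈ W, u X = 0) {L : ℝ}
    (hL : ∀ X, X ∉ boxN N L → u X = 0) {η : ℝ≥0∞} (hη : 0 < η) :
    ∃ d : ℝ, 0 < d ∧ ∀ X, η ≤ u X → ∀ Z ∈ W, d ≤ dist X Z := by
  sorry

/-! ## Card 3 — `landscape-ratio-convexity` -/

/-- **First lemma of the line (Card 3), one slice.** The slice functional
`Φ(f) = (∫ f²)² / (∫ f)²` is midpoint-convex on nonnegative functions: it is the square of the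
quadratic-over-linear (perspective) functional `f ↦ ‖f‖₂²/‖f‖₁`, and both steps are
Cauchy–Schwarz. -/
theorem sliceRatio_midpoint_le (f g : Space → ℝ≥0∞) :
    (∫⁻ x, ((f x + g x) / 2) ^ 2) ^ 2 / (∫⁻ x, (f x + g x) / 2) ^ 2 ≤
      ((∫⁻ x, f x ^ 2) ^ 2 / (∫⁻ x, f x) ^ 2 + (∫⁻ x, g x ^ 2) ^ 2 / (∫⁻ x, g x) ^ 2) / 2 := by
  sorry

/-- **Jensen monotonicity of the landscape functional under the library's product mollifier.**
For nonnegative bounded measurable `Ψ` supported in the box, `∫ L³ m²/s²` does not increase under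
`mollify hr` (`ρ_r = ∏ᵢ β_r(·ᵢ)` is a product over particles: the mollified slice at `Y` is a
`ρ_rest(Y - Y')dY'`-average of the `x`-mollified slices `β_r ⋆ₓ Ψ(·, Y')`; Jensen for the convex
slice functional, Tonelli, and Young `‖β ⋆ f‖₂ ≤ ‖f‖₂`, `‖β ⋆ f‖₁ = ‖f‖₁`). No continuity of `Ψ`,
no uniform convergence, no zero-slice case analysis. -/
theorem landscapeRatio_mollify_le {n : ℕ} (L : ℝ) {r : ℝ} (hr : 0 < r)
    {Ψ : Config (n + 1) → ℝ} (hΨm : Measurable Ψ) (h0 : ∀ X, 0 ≤ Ψ X) {K : ℝ}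
    (hK : ∀ X, Ψ X ≤ K) (hsupp : ∀ X, X ∉ boxN (n + 1) L → Ψ X = 0) :
    ∫⁻ Y : Config n, ENNReal.ofReal (L ^ 3) *
        (∫⁻ x, (‖mollify hr Ψ (Matrix.vecCons x Y)‖₊ : ℝ≥0∞) ^ 2) ^ 2 /
          (∫⁻ x, (‖mollify hr Ψ (Matrix.vecCons x Y)‖₊ : ℝ≥0∞)) ^ 2 ≤
      ∫⁻ Y : Config n, ENNReal.ofReal (L ^ 3) *
        (∫⁻ x, (‖Ψ (Matrix.vecCons x Y)‖₊ : ℝ≥0∞) ^ 2) ^ 2 /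
          (∫⁻ x, (‖Ψ (Matrix.vecCons x Y)‖₊ : ℝ≥0∞)) ^ 2 := by
  sorry

end Summit.AtomisticToContinuum.BoseEinsteinCondensation.Cruxes.WitnessTransfer.IdeatorSketch2

end
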